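import Summits.NavierStokesRegularity.NavierStokesRegularity.Theorems.FilamentSkeletonRssSkeletonJ1RFrameDefs
import Summits.NavierStokesRegularity.NavierStokesRegularity.Theorems.FilamentSkeletonRssSkeletonEquilibriumKernelPerturbation
import Literature.Analysis.FluidPDE.TaoAveragedNondegeneracy

/-!
# Route `FilamentSkeletonRss` · crux `SkeletonJ1R` (stmt-NavierStokesRegularity-23610) · stub F2 `LiaDefectL` — SUB-BRICK (α3): the partners'
# AMBIENT-vs-ACTUAL Biot–Savart mismatch along an arm, with the displacement weight left abstract (director dss_163 (2))

The defect of the LIA reference in stub F2 (line `streamline_kantorovich_R`, skeleton v2 ff0eba9f7176) compares the regularised Biot–Savart field of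
the ACTUAL partner curves `x_k` with the AMBIENT field of the straight datum lines `datumLine k` (`…SkeletonJ1RFrameDefs.ambientField`) that the
reference ODE `IsLiaReference` solves against.  This file bounds, for ONE partner, the difference of the two kernel integrands and of their
integrals at a point `y`, in terms of an ABSTRACT displacement profile (`‖x σ − L σ‖ ≤ η₀ + η₁|σ|`, tilt `‖x′ σ − t‖ ≤ η'`; the S-bend rates that make
these weights small are the F-hand's):
* §1 pointwise (`norm_kernelCross_sub_le`): if `x = L + D` with `‖D‖ ≤ ‖y − L‖/5`, `‖t‖ = 1`, `‖x′‖ ≤ 1`, `‖x′ − t‖ ≤ η'`, then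
  `‖K(‖y−x‖)•(x′ × (y−x)) − K(‖y−L‖)•(t × (y−L))‖ ≤ 25‖D‖/‖y−L‖³ + 2η'/‖y−L‖²` for the crux kernel `K(r) = ((r² + e²)^{3/2})⁻¹` and every
  core parameter `e` (the landed `stub_kernelPerturbation`: `|K(q₀+ρ) − K(q₀)| ≤ 9|ρ|/q₀^{5/2}` for `|ρ| ≤ q₀/2`);
* §2 the line identity `‖y − (P + σ•t)‖² = (‖y−P‖² − ⟪y−P,t⟫²) + (σ − ⟪y−P,t⟫)²` and the majorant integral `∫ (a² + (σ−s)²)⁻¹ dσ = π/a`;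
* §3 integrated (`norm_integral_kernelCross_sub_le`): if moreover `a² + (σ−s)² ≤ ‖y − L σ‖²` for all `σ` (`a > 0`; equality for a straight line at
  distance `a` with foot parameter `s`) and `‖D σ‖ ≤ η₀ + η₁|σ|`, then
  `‖∫ (A − B)‖ ≤ (25(η₀ + η₁|s|)/a + 25η₁ + 2η')·π/a` — uniform in `e`; with `datumLine` as `L` this is the partner-mismatch term of F2
  (`norm_integral_kernelCross_sub_datumLine_le`).
HONEST FRAMING: MODEL rung, ∃-side helper lemmas (elementary kernel calculus) about a HYPOTHETICAL filament-type blow-up skeleton; F2 and the crux 23610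
stay OPEN; nothing here bears on Navier–Stokes regularity, which is NOT proved. [folklore]
-/

-- `dupNamespace` off: the module name repeats `NavierStokesRegularity` by the tree's `Summits/<S>/<S>/Theorems` layout (same as every sibling file).
set_option linter.dupNamespace false

noncomputable section

namespace Summit.NavierStokesRegularity.NavierStokesRegularity.Theorems.SkeletonJ1RMismatchTools

open MeasureTheory Filter Topology
open Literature.Analysis.FluidPDE Literature.Analysis.FluidPDE.Tao2016
open Summit.NavierStokesRegularity.NavierStokesRegularity.Theorems.SkeletonJ1RFrame
open Summit.NavierStokesRegularity.NavierStokesRegularity.Theorems.SkeletonEquilibrium.Sketch (stub_kernelPerturbation)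
open scoped RealInnerProductSpace InnerProductSpace BigOperators

/-! ## §1 The pointwise kernel mismatch -/

/-- `‖v × w‖ ≤ ‖v‖ ‖w‖`. [folklore] -/
private theorem mm_norm_cross_le (v w : EuclideanSpace ℝ (Fin 3)) : ‖cross v w‖ ≤ ‖v‖ * ‖w‖ := by
  rw [norm_cross]; exact mul_le_of_le_one_right (by positivity) (Real.sin_le_one _)

/-- `(r²)^{p} = r^{2p}`-type facts: `(r ^ 2) ^ (3/2) = r ^ 3` and `(r ^ 2) ^ (5/2) = r ^ 5` for `0 ≤ r`. [folklore] -/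
private theorem mm_rpow_sq {r : ℝ} (hr : 0 ≤ r) : (r ^ 2) ^ (3 / 2 : ℝ) = r ^ 3 ∧ (r ^ 2) ^ (5 / 2 : ℝ) = r ^ 5 := by
  constructor
  · rw [show r ^ 2 = r ^ (2:ℝ) by norm_cast, ← Real.rpow_mul hr]; norm_num
  · rw [show r ^ 2 = r ^ (2:ℝ) by norm_cast, ← Real.rpow_mul hr]; norm_num

/-- The regularised kernel is below the bare cube: `((r² + e²)^{3/2})⁻¹ ≤ (r³)⁻¹` for `0 < r`. [folklore] -/
private theorem mm_kernel_le_inv_cube {r : ℝ} (hr : 0 < r) (e : ℝ) : ((r ^ 2 + e ^ 2) ^ (3 / 2 : ℝ))⁻¹ ≤ (r ^ 3)⁻¹ := by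
  rw [← (mm_rpow_sq hr.le).1]
  exact inv_anti₀ (Real.rpow_pos_of_pos (by positivity) _)
    (Real.rpow_le_rpow (by positivity) (by nlinarith [sq_nonneg e]) (by norm_num))

/-- `(r⁵) ≤ (r² + e²)^{5/2}` for `0 < r`. [folklore] -/
private theorem mm_pow_five_le {r : ℝ} (hr : 0 < r) (e : ℝ) : r ^ 5 ≤ (r ^ 2 + e ^ 2) ^ (5 / 2 : ℝ) := by
  rw [← (mm_rpow_sq hr.le).2]
  exact Real.rpow_le_rpow (by positivity) (by nlinarith [sq_nonneg e]) (by norm_num)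

/-- **Pointwise kernel mismatch.**  Let `K(r) = ((r² + e²)^{3/2})⁻¹`.  For a point `y`, a reference point `L` with `0 < ‖y − L‖`, a displaced point
`x = L + D` with `‖D‖ ≤ ‖y − L‖/5`, a unit direction `t` and a direction `x'` with `‖x'‖ ≤ 1`, `‖x' − t‖ ≤ η'`:
`‖K(‖y−x‖)•(x' × (y−x)) − K(‖y−L‖)•(t × (y−L))‖ ≤ 25‖D‖/‖y−L‖³ + 2η'/‖y−L‖²`. [folklore] -/
theorem norm_kernelCross_sub_le (e : ℝ) {y L D t x' : EuclideanSpace ℝ (Fin 3)} {η' : ℝ} (hr : 0 < ‖y - L‖)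
    (hD : ‖D‖ ≤ ‖y - L‖ / 5) (ht : ‖t‖ = 1) (hx'1 : ‖x'‖ ≤ 1) (hx' : ‖x' - t‖ ≤ η') :
    ‖((‖y - (L + D)‖ ^ 2 + e ^ 2) ^ (3 / 2 : ℝ))⁻¹ • cross x' (y - (L + D)) -
        ((‖y - L‖ ^ 2 + e ^ 2) ^ (3 / 2 : ℝ))⁻¹ • cross t (y - L)‖ ≤
      25 * ‖D‖ / ‖y - L‖ ^ 3 + 2 * η' / ‖y - L‖ ^ 2 := by
  set r := ‖y - L‖ with hr_def
  set r' := ‖y - (L + D)‖ with hr'_def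
  set q₀ := r ^ 2 + e ^ 2 with hq₀
  have hDn := norm_nonneg D
  have hη0 : 0 ≤ η' := le_trans (norm_nonneg _) hx'
  -- geometry of the displaced point
  have hyx : y - (L + D) = (y - L) - D := by abel
  have hr'le : r' ≤ 6 / 5 * r := by
    rw [hr'_def, hyx]; exact (norm_sub_le _ _).trans (by rw [← hr_def]; linarith)
  have hr'ge : 4 / 5 * r ≤ r' := by
    rw [hr'_def, hyx]; have := norm_sub_norm_le (y - L) D; rw [← hr_def] at this; linarith
  have hr'pos : 0 < r' := lt_of_lt_of_le (by positivity) hr'ge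
  -- the kernel difference (landed `stub_kernelPerturbation`)
  have hq₀pos : 0 < q₀ := by positivity
  set ρ := r' ^ 2 - r ^ 2 with hρ
  have hρabs : |ρ| ≤ 11 / 5 * r * ‖D‖ := by
    have h1 : |r' - r| ≤ ‖D‖ := by
      calc |r' - r| = |‖(y - L) - D‖ - ‖y - L‖| := by rw [hr'_def, hr_def, hyx]
        _ ≤ ‖((y - L) - D) - (y - L)‖ := abs_norm_sub_norm_le _ _
        _ = ‖D‖ := by rw [show ((y - L) - D) - (y - L) = -D by abel, norm_neg]
    have h2 : ρ = (r' - r) * (r' + r) := by rw [hρ]; ring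
    rw [h2, abs_mul, abs_of_pos (by positivity : 0 < r' + r)]
    calc |r' - r| * (r' + r) ≤ ‖D‖ * (6 / 5 * r + r) := mul_le_mul h1 (by linarith) (by positivity) hDn
      _ = 11 / 5 * r * ‖D‖ := by ring
  have hρsmall : |ρ| ≤ q₀ / 2 := by
    have : 11 / 5 * r * ‖D‖ ≤ 11 / 25 * r ^ 2 := by nlinarith
    have hq : r ^ 2 ≤ q₀ := by rw [hq₀]; nlinarith [sq_nonneg e]
    linarith
  have hKdiff : |((r' ^ 2 + e ^ 2) ^ (3 / 2 : ℝ))⁻¹ - (q₀ ^ (3 / 2 : ℝ))⁻¹| ≤ 9 * |ρ| / q₀ ^ (5 / 2 : ℝ) := by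
    have h := stub_kernelPerturbation q₀ ρ hq₀pos hρsmall
    have : q₀ + ρ = r' ^ 2 + e ^ 2 := by rw [hq₀, hρ]; ring
    rwa [this] at h
  have hq5 : r ^ 5 ≤ q₀ ^ (5 / 2 : ℝ) := by rw [hq₀]; exact mm_pow_five_le hr e
  have hKdiff' : |((r' ^ 2 + e ^ 2) ^ (3 / 2 : ℝ))⁻¹ - (q₀ ^ (3 / 2 : ℝ))⁻¹| ≤ 99 / 5 * ‖D‖ / r ^ 4 := by
    refine hKdiff.trans ?_
    rw [div_le_div_iff₀ (lt_of_lt_of_le (pow_pos hr 5) hq5) (pow_pos hr 4)]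
    calc 9 * |ρ| * r ^ 4 ≤ 9 * (11 / 5 * r * ‖D‖) * r ^ 4 := by gcongr
      _ = 99 / 5 * ‖D‖ * r ^ 5 := by ring
      _ ≤ 99 / 5 * ‖D‖ * q₀ ^ (5 / 2 : ℝ) := by gcongr
  -- the unperturbed kernel
  have hK : ((r ^ 2 + e ^ 2) ^ (3 / 2 : ℝ))⁻¹ ≤ (r ^ 3)⁻¹ := mm_kernel_le_inv_cube hr e
  have hK0 : 0 ≤ ((r ^ 2 + e ^ 2) ^ (3 / 2 : ℝ))⁻¹ := inv_nonneg.2 (Real.rpow_nonneg (by positivity) _)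
  -- split A − B = ΔK • (x' × (y − x)) + K(r) • (x' × (y − x) − t × (y − L))
  have hsplit : ((r' ^ 2 + e ^ 2) ^ (3 / 2 : ℝ))⁻¹ • cross x' (y - (L + D)) - ((r ^ 2 + e ^ 2) ^ (3 / 2 : ℝ))⁻¹ • cross t (y - L) =
      (((r' ^ 2 + e ^ 2) ^ (3 / 2 : ℝ))⁻¹ - (q₀ ^ (3 / 2 : ℝ))⁻¹) • cross x' (y - (L + D)) +
        ((r ^ 2 + e ^ 2) ^ (3 / 2 : ℝ))⁻¹ • (cross x' (y - (L + D)) - cross t (y - L)) := by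
    rw [hq₀, sub_smul, smul_sub]; abel
  -- the cross-product difference: x' × (y − x) − t × (y − L) = (x' − t) × (y − x) − t × D
  have hcross : cross x' (y - (L + D)) - cross t (y - L) = cross (x' - t) (y - (L + D)) - cross t D := by
    have e1 : cross (x' - t) (y - (L + D)) = cross x' (y - (L + D)) - cross t (y - (L + D)) :=
      DFunLike.congr_fun (map_sub crossCLM x' t) (y - (L + D))
    have e2 : cross t (y - (L + D)) = cross t (y - L) - cross t D := by
      rw [hyx]; exact map_sub (crossCLM t) (y - L) D
    rw [e1, e2]; abel
  have hcross_le : ‖cross x' (y - (L + D)) - cross t (y - L)‖ ≤ η' * (6 / 5 * r) + ‖D‖ := by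
    rw [hcross]
    calc ‖cross (x' - t) (y - (L + D)) - cross t D‖ ≤ ‖cross (x' - t) (y - (L + D))‖ + ‖cross t D‖ := norm_sub_le _ _
      _ ≤ ‖x' - t‖ * ‖y - (L + D)‖ + ‖t‖ * ‖D‖ := add_le_add (mm_norm_cross_le _ _) (mm_norm_cross_le _ _)
      _ ≤ η' * (6 / 5 * r) + 1 * ‖D‖ := by rw [ht]; gcongr
      _ = η' * (6 / 5 * r) + ‖D‖ := by ring
  -- assemble
  rw [hsplit]
  have hr3 : 0 < r ^ 3 := pow_pos hr 3
  calc ‖(((r' ^ 2 + e ^ 2) ^ (3 / 2 : ℝ))⁻¹ - (q₀ ^ (3 / 2 : ℝ))⁻¹) • cross x' (y - (L + D)) +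
        ((r ^ 2 + e ^ 2) ^ (3 / 2 : ℝ))⁻¹ • (cross x' (y - (L + D)) - cross t (y - L))‖
      ≤ ‖(((r' ^ 2 + e ^ 2) ^ (3 / 2 : ℝ))⁻¹ - (q₀ ^ (3 / 2 : ℝ))⁻¹) • cross x' (y - (L + D))‖ +
          ‖((r ^ 2 + e ^ 2) ^ (3 / 2 : ℝ))⁻¹ • (cross x' (y - (L + D)) - cross t (y - L))‖ := norm_add_le _ _
    _ ≤ 99 / 5 * ‖D‖ / r ^ 4 * (1 * (6 / 5 * r)) + (r ^ 3)⁻¹ * (η' * (6 / 5 * r) + ‖D‖) := by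
        rw [norm_smul, norm_smul, Real.norm_eq_abs, Real.norm_of_nonneg hK0]
        refine add_le_add (mul_le_mul hKdiff' ?_ (norm_nonneg _) (by positivity)) (mul_le_mul hK hcross_le (norm_nonneg _) (by positivity))
        exact (mm_norm_cross_le _ _).trans (mul_le_mul hx'1 hr'le (norm_nonneg _) (by norm_num))
    _ = (619 / 25 * ‖D‖ + 6 / 5 * η' * r) / r ^ 3 := by field_simp; try ring
    _ ≤ (25 * ‖D‖ + 2 * η' * r) / r ^ 3 :=
        div_le_div_of_nonneg_right (by nlinarith [hDn, hη0, hr.le]) hr3.le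
    _ = 25 * ‖D‖ / r ^ 3 + 2 * η' / r ^ 2 := by field_simp; try ring

/-! ## §2 The straight line and the majorant integral -/

/-- Distance to a straight line: `‖y − (P + σ•t)‖² = (‖y−P‖² − ⟪y−P, t⟫²) + (σ − ⟪y−P, t⟫)²` for a unit direction `t`. [folklore] -/
theorem norm_sub_line_sq (y P t : EuclideanSpace ℝ (Fin 3)) (ht : ‖t‖ = 1) (σ : ℝ) :
    ‖y - (P + σ • t)‖ ^ 2 = (‖y - P‖ ^ 2 - ⟪y - P, t⟫ ^ 2) + (σ - ⟪y - P, t⟫) ^ 2 := by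
  have h : y - (P + σ • t) = (y - P) - σ • t := by abel
  rw [h, norm_sub_sq_real, real_inner_smul_right, norm_smul, Real.norm_eq_abs, mul_pow, sq_abs, ht]
  ring

/-- The Cauchy majorant: `∫ (a² + (σ − s)²)⁻¹ dσ = π/a` for `0 < a`. [folklore] -/
theorem integral_inv_sq_add_sq {a : ℝ} (ha : 0 < a) (s : ℝ) : ∫ σ : ℝ, (a ^ 2 + (σ - s) ^ 2)⁻¹ = Real.pi / a := by
  have h1 : (fun σ : ℝ => (a ^ 2 + (σ - s) ^ 2)⁻¹) = fun σ : ℝ => (fun u : ℝ => (a ^ 2 + u ^ 2)⁻¹) (σ - s) := rfl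
  rw [h1, integral_sub_right_eq_self (μ := (volume : Measure ℝ)) (fun u : ℝ => (a ^ 2 + u ^ 2)⁻¹) s]
  have h2 : (fun u : ℝ => (a ^ 2 + u ^ 2)⁻¹) = fun u : ℝ => (a ^ 2)⁻¹ * (fun v : ℝ => (1 + v ^ 2)⁻¹) (a⁻¹ * u) := by
    funext u; field_simp
  rw [h2, MeasureTheory.integral_const_mul, Measure.integral_comp_mul_left (fun v : ℝ => (1 + v ^ 2)⁻¹) a⁻¹,
    integral_univ_inv_one_add_sq, inv_inv, smul_eq_mul, abs_of_pos ha]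
  field_simp

/-- Integrability of the shifted, scaled Cauchy majorant. [folklore] -/
theorem integrable_inv_sq_add_sq {a : ℝ} (ha : 0 < a) (s : ℝ) : Integrable fun σ : ℝ => (a ^ 2 + (σ - s) ^ 2)⁻¹ := by
  have h1 : Integrable (fun v : ℝ => (1 + (v - a⁻¹ * s) ^ 2)⁻¹) := integrable_inv_one_add_sq.comp_sub_right _
  have h2 : Integrable (fun σ : ℝ => (1 + (a⁻¹ * σ - a⁻¹ * s) ^ 2)⁻¹) := h1.comp_mul_left' (inv_ne_zero ha.ne')
  have h3 : (fun σ : ℝ => (a ^ 2 + (σ - s) ^ 2)⁻¹) = fun σ : ℝ => (a ^ 2)⁻¹ * (1 + (a⁻¹ * σ - a⁻¹ * s) ^ 2)⁻¹ := by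
    funext σ; field_simp
  rw [h3]; exact h2.const_mul _

/-! ## §3 The integrated mismatch for one partner -/

/-- **Integrated kernel mismatch for one partner, abstract displacement weight.**  Let `L, x : ℝ → ℝ³` (reference line and actual partner) and a point
`y` with `a² + (σ − s)² ≤ ‖y − L σ‖²` for all `σ` (`0 < a`; equality for a straight line at distance `a`, foot parameter `s`), displacement
`‖x σ − L σ‖ ≤ η₀ + η₁|σ|` and `‖x σ − L σ‖ ≤ ‖y − L σ‖/5`, `‖x′‖ ≤ 1`, unit direction `t` with `‖x′ σ − t‖ ≤ η'`.  Then for every `e`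
`‖∫ [K(‖y−xσ‖)•(x′σ × (y−xσ)) − K(‖y−Lσ‖)•(t × (y−Lσ))] dσ‖ ≤ (25(η₀ + η₁|s|)/a + 25η₁ + 2η')·π/a`. [folklore] -/
theorem norm_integral_kernelCross_sub_le (e : ℝ) {L x : ℝ → EuclideanSpace ℝ (Fin 3)} {y t : EuclideanSpace ℝ (Fin 3)}
    {a s η₀ η₁ η' : ℝ} (ha : 0 < a) (hη₀ : 0 ≤ η₀) (hη₁ : 0 ≤ η₁) (ht : ‖t‖ = 1)
    (hline : ∀ σ, a ^ 2 + (σ - s) ^ 2 ≤ ‖y - L σ‖ ^ 2) (hdisp : ∀ σ, ‖x σ - L σ‖ ≤ η₀ + η₁ * |σ|)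
    (hsmall : ∀ σ, ‖x σ - L σ‖ ≤ ‖y - L σ‖ / 5) (hunit : ∀ σ, ‖deriv x σ‖ ≤ 1) (htilt : ∀ σ, ‖deriv x σ - t‖ ≤ η') :
    ‖∫ σ : ℝ, (((‖y - x σ‖ ^ 2 + e ^ 2) ^ (3 / 2 : ℝ))⁻¹ • cross (deriv x σ) (y - x σ) -
        ((‖y - L σ‖ ^ 2 + e ^ 2) ^ (3 / 2 : ℝ))⁻¹ • cross t (y - L σ))‖ ≤
      (25 * (η₀ + η₁ * |s|) / a + 25 * η₁ + 2 * η') * (Real.pi / a) := by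
  have hη0 : 0 ≤ η' := le_trans (norm_nonneg _) (htilt 0)
  set M : ℝ := 25 * (η₀ + η₁ * |s|) / a + 25 * η₁ + 2 * η' with hM
  have hM0 : 0 ≤ M := by positivity
  -- pointwise majorant M · (a² + (σ − s)²)⁻¹
  have hbound : ∀ σ, ‖((‖y - x σ‖ ^ 2 + e ^ 2) ^ (3 / 2 : ℝ))⁻¹ • cross (deriv x σ) (y - x σ) -
      ((‖y - L σ‖ ^ 2 + e ^ 2) ^ (3 / 2 : ℝ))⁻¹ • cross t (y - L σ)‖ ≤ M * (a ^ 2 + (σ - s) ^ 2)⁻¹ := by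
    intro σ
    set r := ‖y - L σ‖ with hr
    have hq : 0 < a ^ 2 + (σ - s) ^ 2 := by positivity
    have hr2 : a ^ 2 + (σ - s) ^ 2 ≤ r ^ 2 := hline σ
    have hrpos : 0 < r := by
      by_contra h
      have h0 : r = 0 := le_antisymm (not_lt.1 h) (by rw [hr]; exact norm_nonneg _)
      rw [h0] at hr2; nlinarith [sq_nonneg (σ - s)]
    have har : a ≤ r := by
      have h := Real.sqrt_le_sqrt (show a ^ 2 ≤ r ^ 2 by nlinarith [sq_nonneg (σ - s)])
      rwa [Real.sqrt_sq ha.le, Real.sqrt_sq hrpos.le] at h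
    have hσs : |σ - s| ≤ r := by
      have h := Real.sqrt_le_sqrt (show (σ - s) ^ 2 ≤ r ^ 2 by nlinarith)
      rwa [Real.sqrt_sq_eq_abs, Real.sqrt_sq hrpos.le] at h
    have hxD : x σ = L σ + (x σ - L σ) := by abel
    have hpt := norm_kernelCross_sub_le e (y := y) (L := L σ) (D := x σ - L σ) (t := t) (x' := deriv x σ) hrpos (hsmall σ) ht
      (hunit σ) (htilt σ)
    rw [← hxD] at hpt
    refine hpt.trans ?_
    -- 25‖D‖/r³ + 2η'/r² ≤ M (a² + (σ−s)²)⁻¹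
    have hD := hdisp σ
    have hσ : |σ| ≤ |σ - s| + |s| := by
      calc |σ| = |(σ - s) + s| := by rw [sub_add_cancel]
        _ ≤ _ := abs_add_le _ _
    have hDle : ‖x σ - L σ‖ ≤ (η₀ + η₁ * |s|) + η₁ * r := by
      have h1 : η₁ * |σ| ≤ η₁ * (r + |s|) := mul_le_mul_of_nonneg_left (hσ.trans (by linarith)) hη₁
      linarith
    rw [← hr]
    have hr3 : 0 < r ^ 3 := pow_pos hrpos 3
    calc 25 * ‖x σ - L σ‖ / r ^ 3 + 2 * η' / r ^ 2
        ≤ 25 * ((η₀ + η₁ * |s|) + η₁ * r) / r ^ 3 + 2 * η' / r ^ 2 := by gcongr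
      _ = (25 * (η₀ + η₁ * |s|) / r + 25 * η₁ + 2 * η') / r ^ 2 := by field_simp; try ring
      _ ≤ M / r ^ 2 := by
          rw [hM]; gcongr
      _ ≤ M * (a ^ 2 + (σ - s) ^ 2)⁻¹ := by
          rw [div_eq_mul_inv]; exact mul_le_mul_of_nonneg_left (inv_anti₀ hq hr2) hM0
  have hint : Integrable (fun σ : ℝ => M * (a ^ 2 + (σ - s) ^ 2)⁻¹) := (integrable_inv_sq_add_sq ha s).const_mul M
  calc ‖∫ σ : ℝ, (((‖y - x σ‖ ^ 2 + e ^ 2) ^ (3 / 2 : ℝ))⁻¹ • cross (deriv x σ) (y - x σ) -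
        ((‖y - L σ‖ ^ 2 + e ^ 2) ^ (3 / 2 : ℝ))⁻¹ • cross t (y - L σ))‖
      ≤ ∫ σ : ℝ, M * (a ^ 2 + (σ - s) ^ 2)⁻¹ := norm_integral_le_of_norm_le hint (Eventually.of_forall hbound)
    _ = M * (Real.pi / a) := by rw [MeasureTheory.integral_const_mul, integral_inv_sq_add_sq ha s]

/-- **The same bound against a straight DATUM LINE** (`…SkeletonJ1RFrameDefs.datumLine`, unit datum direction): the hypothesis
`a² + (σ−s)² ≤ ‖y − L σ‖²` holds with EQUALITY for `a² = ‖y − w‖² − ⟪y − w, t k⟫²`, `s = ⟪y − w, t k⟫`, `w = waistPt` — the partner-mismatch term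
of stub F2 for one partner `k`, with abstract displacement weight. [folklore] -/
theorem norm_integral_kernelCross_sub_datumLine_le {N : ℕ} (Γ : ℝ) (p t : Fin N → EuclideanSpace ℝ (Fin 3)) (s₀ : Fin N → ℝ) (k : Fin N)
    (e : ℝ) {x : ℝ → EuclideanSpace ℝ (Fin 3)} {y : EuclideanSpace ℝ (Fin 3)} {a η₀ η₁ η' : ℝ} (ha : 0 < a)
    (hη₀ : 0 ≤ η₀) (hη₁ : 0 ≤ η₁) (ht : ‖t k‖ = 1)
    (hdist : a ^ 2 ≤ ‖y - waistPt Γ p t s₀ k‖ ^ 2 - ⟪y - waistPt Γ p t s₀ k, t k⟫ ^ 2)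
    (hdisp : ∀ σ, ‖x σ - datumLine Γ p t s₀ k σ‖ ≤ η₀ + η₁ * |σ|)
    (hsmall : ∀ σ, ‖x σ - datumLine Γ p t s₀ k σ‖ ≤ ‖y - datumLine Γ p t s₀ k σ‖ / 5) (hunit : ∀ σ, ‖deriv x σ‖ ≤ 1)
    (htilt : ∀ σ, ‖deriv x σ - t k‖ ≤ η') :
    ‖∫ σ : ℝ, (((‖y - x σ‖ ^ 2 + e ^ 2) ^ (3 / 2 : ℝ))⁻¹ • cross (deriv x σ) (y - x σ) -
        ((‖y - datumLine Γ p t s₀ k σ‖ ^ 2 + e ^ 2) ^ (3 / 2 : ℝ))⁻¹ • cross (t k) (y - datumLine Γ p t s₀ k σ))‖ ≤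
      (25 * (η₀ + η₁ * |⟪y - waistPt Γ p t s₀ k, t k⟫|) / a + 25 * η₁ + 2 * η') * (Real.pi / a) := by
  refine norm_integral_kernelCross_sub_le e ha hη₀ hη₁ ht (fun σ => ?_) hdisp hsmall hunit htilt
  unfold datumLine
  rw [norm_sub_line_sq y (waistPt Γ p t s₀ k) (t k) ht σ]
  linarith

end Summit.NavierStokesRegularity.NavierStokesRegularity.Theorems.SkeletonJ1RMismatchTools

end
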